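import Summits.ValiantsHypothesis.ValiantsHypothesis.Theorems.BlockLaplaceExpansion
import Literature.Computability.AlgebraicComplexity.SetMultilinearProjectionCircuit
import Literature.Computability.AlgebraicComplexity.StandardFamilies
import HarnessLib

/-!
# The exact-cover polynomial and a syntactically multilinear circuit for `per_(mc)`
(decomposition workshop `decomp-valiant`, lens 6 «restricted-models lifting axis», gen 3; support
kernel for the split of `DecompCycle1.TamePer` into the crux `PerNotSmVP`
(stmt-ValiantsHypothesis-23661) and the lifting residual `TameOrSmLift`
(stmt-ValiantsHypothesis-23662))

* `perPoly_eq_aeval_xcPoly`: on `Fin (m c)` with `m` blocks of `c` consecutive rows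
  (`rowBlock`), `per_(mc) = XC_(c,m)(φ)` where
  `XC_(c,m) = ∑_((S_b) pairwise disjoint c-sets) ∏_b Y_(b,S_b)` (`xcPoly`, set-multilinear in the
  `m` blocks: `isSetMultilinear_xcPoly`) and `φ(b,J) = per X[B_b, J]` (`leafPoly`) is block-local.
* `exists_smCircuit_perPoly` (the MECHANISM THEOREM, unconditional): a fan-in-two syntactically
  multilinear circuit for `per_(mc)` of size `≤ (2·4^c·L(per_c))·(m·C(mc,c)) + 2·4^m·L(XC_(c,m))`,
  by Limaye–Srinivasan–Tavenas Lemma 12 in the tree's straight-line form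
  (`SmlHomogenise.exists_smlProj_gateList`, `iterate_targets`) once per leaf (blocks = the `c` rows
  of the minor) and once at the top (blocks = the `m` row blocks, pairwise disjoint row budgets);
  `smCircuitSize_perPoly_le` is the size form.

HONEST FRAMING: circuit bookkeeping of published constructions (block Laplace expansion,
Limaye–Srinivasan–Tavenas Lemma 12, Valiant's criterion); nothing here bears on the truth of
`VP ≠ VNP`.

## References

* [Minc1978] H. Minc, *Permanents*, Addison–Wesley 1978, Ch. 2, Thm. 1.2 (Laplace expansion).
* [LimayeSrinivasanTavenas2025] N. Limaye, S. Srinivasan, S. Tavenas, J. ACM 72 (2025), Art. 26,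
  Lemma 12.
* [Burgisser2000] P. Bürgisser, *Completeness and Reduction in Algebraic Complexity Theory*,
  Springer 2000, Def. 2.1, Prop. 2.20, Rem. 2.2.
* [RazYehudayoff2008] R. Raz, A. Yehudayoff, Comput. Complexity 17 (2008), §2.
-/

noncomputable section

namespace Summit.ValiantsHypothesis.ValiantsHypothesis.Theorems.BlockLaplaceCircuit

open Finset Matrix Summit.ValiantsHypothesis.ValiantsHypothesis.Theorems.BlockLaplaceExpansion

/-! ## Part II — the concrete block structure on `Fin (m*c)`, the exact-cover polynomial `XC_{c,m}` -/

section Concrete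

open MvPolynomial Literature.Computability.AlgebraicComplexity

variable (R : Type*) [CommSemiring R]

/-- The `c`-subsets of `Fin n` (column sets of the `c × c` minors). [folklore] -/
abbrev PowC (n c : ℕ) : Type := {J : Finset (Fin n) // J.card = c}

/-- Row `i < m*c` lies in block `⌊i / c⌋` (via `finProdFinEquiv : Fin m × Fin c ≃ Fin (m*c)`). [folklore] -/
def rowBlock (m c : ℕ) : Fin (m * c) → Fin m := fun i => (finProdFinEquiv.symm i).1

/-- Enumeration of the rows of block `b`. [folklore] -/
def rowEnum (m c : ℕ) (b : Fin m) : Fin c ≃ ↥(blockRows (rowBlock m c) b) where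
  toFun r := ⟨finProdFinEquiv (b, r), by simp [rowBlock]⟩
  invFun p := (finProdFinEquiv.symm (p : Fin (m * c))).2
  left_inv r := by simp
  right_inv p := by
    obtain ⟨i, hi⟩ := p
    rw [mem_blockRows] at hi
    apply Subtype.ext
    simp only
    conv_rhs => rw [← finProdFinEquiv.apply_symm_apply i]
    congr 1
    exact Prod.ext (by simpa [rowBlock] using hi.symm) rfl

/-- Each block has `c` rows. [folklore] -/
theorem card_blockRows_rowBlock (m c : ℕ) (b : Fin m) :
    (blockRows (rowBlock m c) b).card = c := by
  rw [← Fintype.card_coe, ← Fintype.card_congr (rowEnum m c b), Fintype.card_fin]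

/-- Ordered families of pairwise disjoint `c`-subsets, one per block. [folklore] -/
def famSet (m c : ℕ) : Finset (Fin m → PowC (m * c) c) :=
  Finset.univ.filter fun T => ∀ b b', b ≠ b' → Disjoint (T b).1 (T b').1

/-- **The exact-cover polynomial** `XC_{c,m} = ∑_{(S_b)_b pairwise disjoint c-sets} ∏_b Y_{b,S_b}`
in the variables `Y_{b,J}` (`b < m`, `J` a `c`-subset of `Fin (m c)`): degree `m`, set-multilinear
in the blocks `b`. [folklore] -/
def xcPoly (m c : ℕ) : MvPolynomial (Fin m × PowC (m * c) c) R :=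
  ∑ T ∈ famSet m c, ∏ b, X (b, T b)

/-- The `c × c` permanental minor of the generic matrix on the rows of block `b` and the columns
`J`, as a bijection sum. [cite: Minc1978, Ch. 2, §2.1] -/
def leafPoly (m c : ℕ) (b : Fin m) (J : PowC (m * c) c) :
    MvPolynomial (Fin (m * c) × Fin (m * c)) R :=
  bijSum (Matrix.mvPolynomialX (Fin (m * c)) (Fin (m * c)) R) (blockRows (rowBlock m c) b) J.1

/-- **Block Laplace self-reduction of the permanent**: `per_{mc}(X) = XC_{c,m}(φ)` with the
block-local leaves `φ(b,J) = per X[B_b, J]`. [cite: Minc1978, Ch. 2, Thm. 1.2] -/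
theorem perPoly_eq_aeval_xcPoly (m c : ℕ) :
    perPoly (Fin (m * c)) R =
      aeval (fun v : Fin m × PowC (m * c) c => leafPoly R m c v.1 v.2) (xcPoly R m c) := by
  classical
  unfold perPoly
  rw [permanent_eq_sum_colFamilies (rowBlock m c)]
  simp only [xcPoly, map_sum, map_prod, aeval_X, leafPoly]
  symm
  refine Finset.sum_bij' (fun T _ => fun b => (T b).1)
    (fun S hS => fun b => ⟨S b, ((mem_colFamilies.1 hS).1 b).trans (card_blockRows_rowBlock m c b)⟩)
    ?_ ?_ ?_ ?_ ?_
  · intro T hT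
    exact mem_colFamilies.2 ⟨fun b => (T b).2.trans (card_blockRows_rowBlock m c b).symm,
      (Finset.mem_filter.1 hT).2⟩
  · intro S hS
    exact Finset.mem_filter.2 ⟨Finset.mem_univ _, (mem_colFamilies.1 hS).2⟩
  · intro T hT; rfl
  · intro S hS; rfl
  · intro T hT; rfl

/-! ### Set-multilinearity -/

/-- A product of variables, one from each block of `s`, is set-multilinear over `s`. [cite: LimayeSrinivasanTavenas2025, §2] -/
theorem isSetMultilinear_prod_X {σ ι : Type*} [DecidableEq ι] (blk : σ → ι)
    (s : Finset ι) (g : ι → σ) (hg : ∀ i ∈ s, blk (g i) = i) :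
    IsSetMultilinear blk s (∏ i ∈ s, (X (g i) : MvPolynomial σ R)) := by
  induction s using Finset.induction_on with
  | empty =>
    have h := isSetMultilinear_C (R := R) (σ := σ) blk (1 : R)
    rwa [C_1, ← Finset.prod_empty (f := fun i => (X (g i) : MvPolynomial σ R))] at h
  | @insert a s ha ih =>
    rw [Finset.prod_insert ha]
    have h1 : IsSetMultilinear blk {a} (X (g a) : MvPolynomial σ R) := by
      have := isSetMultilinear_X (R := R) blk (g a)
      rwa [hg a (Finset.mem_insert_self a s)] at this
    have h2 : IsSetMultilinear blk s (∏ i ∈ s, (X (g i) : MvPolynomial σ R)) :=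
      ih fun i hi => hg i (Finset.mem_insert_of_mem hi)
    have h3 : Disjoint ({a} : Finset ι) s := Finset.disjoint_singleton_left.2 ha
    have h4 := IsSetMultilinear.mul blk h1 h2 h3
    have h5 : ({a} : Finset ι) ∪ s = insert a s := (Finset.insert_eq a s).symm
    rw [h5] at h4
    exact h4

/-- `XC_{c,m}` is set-multilinear in the blocks `b` (all of them). [cite: LimayeSrinivasanTavenas2025, §2] -/
theorem isSetMultilinear_xcPoly (m c : ℕ) :
    IsSetMultilinear (Prod.fst : Fin m × PowC (m * c) c → Fin m) Finset.univ (xcPoly R m c) := by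
  classical
  unfold xcPoly
  refine IsSetMultilinear.sum _ _ fun T _ => ?_
  exact isSetMultilinear_prod_X R Prod.fst Finset.univ (fun b => (b, T b)) fun b _ => rfl

/-- `per_c` is set-multilinear in its rows. [cite: LimayeSrinivasanTavenas2025, §2] -/
theorem isSetMultilinear_perPoly (c : ℕ) :
    IsSetMultilinear (Prod.fst : Fin c × Fin c → Fin c) Finset.univ (perPoly (Fin c) R) := by
  classical
  unfold perPoly
  rw [← Literature.Combinatorics.Enumerative.sum_perm_prod_apply_eq_permanent]
  refine IsSetMultilinear.sum _ _ fun σ _ => ?_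
  have : (∏ i, Matrix.mvPolynomialX (Fin c) (Fin c) R i (σ i)) =
      ∏ i ∈ Finset.univ, (X ((fun i => (i, σ i)) i) : MvPolynomial (Fin c × Fin c) R) := by
    rfl
  rw [this]
  exact isSetMultilinear_prod_X R Prod.fst Finset.univ (fun i => (i, σ i)) fun i _ => rfl

end Concrete

/-! ## Part III — the syntactically multilinear circuit (LST Lemma 12 at the leaves and at the top) -/

section Circuit

open MvPolynomial Literature.Computability.AlgebraicComplexity ArithCircuit SmlHomogenise

variable (R : Type*) [CommSemiring R]

/-- Increasing enumeration of a `c`-set of columns. [folklore] -/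
def colEnum {n c : ℕ} (J : PowC n c) : Fin c ≃ ↥(J.1) := (J.1.orderIsoOfFin J.2).toEquiv

/-- Evaluating the generic permanent (any commutative semiring of coefficients):
`aeval g per = per (g (i, j))`. [cite: Burgisser2000, (2.2)] -/
theorem aeval_perPoly' {ι A : Type*} [Fintype ι] [DecidableEq ι] [CommSemiring A] [Algebra R A]
    (g : ι × ι → A) : aeval g (perPoly ι R) = (Matrix.of fun i j : ι => g (i, j)).permanent := by
  simp [perPoly, Matrix.permanent, map_sum, map_prod]

/-- The leaf `per X[B_b, J]` is the `c × c` generic permanent evaluated at the variables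
`X (row_b r, col_J s)`. [cite: Minc1978, Ch. 2, §2.1] -/
theorem leafPoly_eq_aeval (m c : ℕ) (b : Fin m) (J : PowC (m * c) c) :
    leafPoly R m c b J = aeval (fun rs : Fin c × Fin c =>
      (X ((rowEnum m c b rs.1 : Fin (m * c)), (colEnum J rs.2 : Fin (m * c))) :
        MvPolynomial (Fin (m * c) × Fin (m * c)) R)) (perPoly (Fin c) R) := by
  classical
  rw [aeval_perPoly']
  unfold leafPoly bijSum
  rw [Literature.Combinatorics.Enumerative.sum_equiv_prod_eq_permanent_submatrix _ _ _
    (rowEnum m c b) (colEnum J)]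
  rfl

/-- **Mechanism theorem (block Laplace lift), circuit form.** For every `m, c` there is a
fan-in-two syntactically multilinear circuit for `per_{mc}` of size at most
`(2·4^c·L(per_c)) · (m · C(mc,c)) + 2·4^m · L(XC_{c,m})` — the `m · C(mc,c)` leaves `per X[B_b,J]`
each by a syntactically multilinear circuit of size `2·4^c·L(per_c)` (Limaye–Srinivasan–Tavenas
Lemma 12 on the rows of the `c × c` minor), then Lemma 12 once more on an optimal circuit for the
exact-cover polynomial `XC_{c,m}` (set-multilinear in the `m` blocks, leaves in pairwise disjoint
row budgets), using `per_{mc} = XC_{c,m}(leaves)`. [cite: LimayeSrinivasanTavenas2025, Lemma 12] -/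
theorem exists_smCircuit_perPoly (m c : ℕ) :
    ∃ P : ArithCircuit R (Fin (m * c) × Fin (m * c)), P.IsFanInTwo ∧
      IsSyntacticallyMultilinear P ∧ P.Computes (perPoly (Fin (m * c)) R) ∧
      P.size ≤ (2 * 4 ^ c * complexity (perPoly (Fin c) R)) * (m * Fintype.card (PowC (m * c) c)) +
        2 * 4 ^ m * complexity (xcPoly R m c) := by
  classical
  let τ := Fin (m * c) × Fin (m * c)
  let V : Fin m → Finset τ := fun b => blockRows (rowBlock m c) b ×ˢ Finset.univ
  have hV : ∀ b b' : Fin m, b ≠ b' → Disjoint (V b) (V b') := fun b b' h =>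
    Finset.disjoint_product.2 (Or.inl (disjoint_blockRows _ h))
  -- Step A: the leaves `per X[B_b, J]`, each inside the row budget of its block
  obtain ⟨Γc, hΓc2, hΓcf, hΓcs⟩ :=
    ArithCircuit.exists_computes_size_eq_complexity (perPoly (Fin c) R)
  obtain ⟨gs₁, -, h2₁, hsm₁, hlen₁, hleaves⟩ :=
    iterate_targets (Finset.univ : Finset (Fin m × PowC (m * c) c))
      (fun v => leafPoly R m c v.1 v.2) (fun v => V v.1) (2 * 4 ^ c * complexity (perPoly (Fin c) R))
      (gs := ([] : List (Gate R τ))) (by simp) (isSyntacticallyMultilinear_of_gates_eq_nil rfl)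
      (by
        rintro ⟨b, J⟩ - gs' - h2' hsm'
        obtain ⟨gs'', hpre, h2'', hsm'', hlen'', havail⟩ :=
          exists_smlProj_gateList (Prod.fst : Fin c × Fin c → Fin c)
            (fun rs : Fin c × Fin c => (X ((rowEnum m c b rs.1 : Fin (m * c)),
              (colEnum J rs.2 : Fin (m * c))) : MvPolynomial τ R))
            (fun r : Fin c =>
              ({(rowEnum m c b r : Fin (m * c))} : Finset (Fin (m * c))) ×ˢ Finset.univ)
            (fun r r' hrr' => Finset.disjoint_product.2 (Or.inl (by
              rw [Finset.disjoint_singleton]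
              exact fun h => hrr' ((rowEnum m c b).injective (Subtype.ext h)))))
            h2' hsm'
            (fun rs => ⟨.var ((rowEnum m c b rs.1 : Fin (m * c)), (colEnum J rs.2 : Fin (m * c))),
              trivial, rfl, by simp⟩)
            Γc hΓc2
        obtain ⟨u, hu, hval, hvars⟩ := havail Finset.univ
        refine ⟨gs'', hpre, h2'', hsm'', ?_, u, hu, ?_, ?_⟩
        · simpa [hΓcs] using hlen''
        · rw [hval, show Γc.eval = perPoly (Fin c) R from hΓcf,
            (isSetMultilinear_perPoly R c).smlProj_eq, leafPoly_eq_aeval]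
        · refine hvars.trans ?_
          intro x hx
          simp only [Finset.mem_biUnion, Finset.mem_univ, true_and] at hx
          obtain ⟨r, hr⟩ := hx
          have hx1 : x.1 = (rowEnum m c b r : Fin (m * c)) := by
            rw [Finset.mem_product, Finset.mem_singleton] at hr
            exact hr.1
          show x ∈ blockRows (rowBlock m c) b ×ˢ Finset.univ
          rw [Finset.mem_product]
          exact ⟨hx1 ▸ (rowEnum m c b r).2, Finset.mem_univ _⟩)
  -- Step B: Lemma 12 on an optimal circuit for `XC_{c,m}`, leaves from Step A
  obtain ⟨Γ, hΓ2, hΓf, hΓs⟩ := ArithCircuit.exists_computes_size_eq_complexity (xcPoly R m c)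
  obtain ⟨gs, -, h2, hsm, hlen, havail⟩ :=
    exists_smlProj_gateList (Prod.fst : Fin m × PowC (m * c) c → Fin m)
      (fun v => leafPoly R m c v.1 v.2) V hV h2₁ hsm₁ (fun v => hleaves v (Finset.mem_univ v))
      Γ hΓ2
  obtain ⟨u, -, hval, -⟩ := havail Finset.univ
  have hP : (⟨gs, u⟩ : ArithCircuit R τ).Computes (perPoly (Fin (m * c)) R) := by
    show u.eval (gateValues gs) = _
    rw [hval, show Γ.eval = xcPoly R m c from hΓf, (isSetMultilinear_xcPoly R m c).smlProj_eq,
      ← perPoly_eq_aeval_xcPoly]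
  refine ⟨⟨gs, u⟩, h2, (SmAppend.isSyntacticallyMultilinear_iff_gates gs (Operand.gate 0) u).mp hsm,
    hP, ?_⟩
  have h1 : gs₁.length ≤ 2 * 4 ^ c * complexity (perPoly (Fin c) R) *
      (m * Fintype.card (PowC (m * c) c)) := by
    simpa [Finset.card_univ, Fintype.card_prod, Fintype.card_fin] using hlen₁
  rw [Fintype.card_fin, hΓs] at hlen
  exact hlen.trans (Nat.add_le_add_right h1 _)

/-- **Mechanism theorem, size form**: `smCircuitSize (per_{mc}) ≤ (2·4^c·L(per_c))·(m·C(mc,c)) +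
2·4^m·L(XC_{c,m})`. [cite: LimayeSrinivasanTavenas2025, Lemma 12] -/
theorem smCircuitSize_perPoly_le (m c : ℕ) :
    smCircuitSize (perPoly (Fin (m * c)) R) ≤
      ((2 * 4 ^ c * complexity (perPoly (Fin c) R)) * (m * Fintype.card (PowC (m * c) c)) +
        2 * 4 ^ m * complexity (xcPoly R m c) : ℕ) := by
  obtain ⟨P, h2, hsm, hf, hs⟩ := exists_smCircuit_perPoly R m c
  exact (smCircuitSize_le h2 hsm hf).trans (by exact_mod_cast hs)

end Circuit

end Summit.ValiantsHypothesis.ValiantsHypothesis.Theorems.BlockLaplaceCircuit
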